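import Summits.ResolutionOfSingularities.ResolutionOfSingularities.Theorems.PurelyInseparableDim4ResConeHeavyEntryFrame
import Summits.ResolutionOfSingularities.ResolutionOfSingularities.Theorems.PurelyInseparableDim4ResConeGoodInvariant
import HarnessLib
import HarnessLib.Audit.Tags

/-!
# Purely inseparable four-folds — A PERMANENT SET OF FROZEN WEIGHT `≥ p − d` KILLS THE TAIL, EVERY PRIME `p`, EVERY SHADE `d`
# (pure weight ledger + FT; K2(p) lane, SLICE C and beyond — no `e_G` hypothesis; file-holder res-dim4-p-5 g5)

[OURS · counted 0 · cell `res-dim4-pi` · K2(p) lane (general-`p` programme) · seat p-5 g5.]  Nothing here proves K2(p) for any `p`,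
`NoIsolatedTrap p p` or resolution of singularities in dimension ≥ 4 / characteristic `p` — NOT proved; a LEDGER fact about OUR frame.
AI kernel work, weaker than expert review.

THE LEDGER.  On a constant-shade-`d` tail the weights obey (`tail_weights_laws`): the newborn weighs `|r_m| + d − p ≥ 1`, a kept letter
keeps its weight, a translated letter is lost, and `p < |r_m| + d < 2p`.  If a set `P` of letters is PERMANENT from time `M` (never
charted, never translated) its weights are frozen, and if their sum `W` satisfies `W + d ≥ p` then
`|r_{m+1}| ≥ (|r_m| + d − p) + W ≥ |r_m|`: the MASS NEVER DROPS.  At a SATELLITE step `k + 1` (FT: beyond every index) the old newborn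
`j k ∉ P`, of weight `≥ 1`, is kept as well, so the mass RISES by `≥ 1`.  Infinitely many rises contradict `|r_m| < 2p − d`.
* `degree_succ_ge_of_permanentSet` — the one-step ledger: `|r_m| + (weight of any further kept letter) ≤ |r_{m+1}|` when `W + d ≥ p`.
* **`no_tail_of_permanent_weight_ge (p)`** — no witnessed isolated above-floor `Step0 p` chain with `x^{r₀} ∣ F₀` and constant shade `d`
  from `k₀` has, from some `M ≥ k₀`, a permanent set `P` with `p ≤ d + Σ_{z ∈ P} r_M z`.
* **`no_tail_of_permanent_heavy_letter (p)`** — the one-letter case: no permanent letter `h` (`j m ≠ h ∧ b m h = 0` for all `m ≥ M`) with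
  `p ≤ d + r_M h`.  This is the class «permanent heavy-enough letter, `r h + n = p`, `n ≤ d`» — dead by the ledger alone, with NO
  run frame, NO `e_G` and NO positivity hypothesis; what survives in the permanent-letter branch (B) of `good_or_permanent` is
  therefore only FROZEN WEIGHT `W < p − d` (light permanent sets).
[cite: CossartJannsenSaito2020, Thm. 3.14, Lemma 13.2] [cite: HauserPerlega2019PRIMS, §2 (transform D′ of D)]
bears_on: LADDER-RESOLUTION:D157-DOOR2 (res-dim4-pi · K2(p) = `RidgeBudget.NoAboveFloorTrap p p` · permanent-letter class: heavy part dead).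
Supports stmt-ResolutionOfSingularities-16155 (helper).
-/

set_option linter.dupNamespace false -- mandated namespace of this single-conjunct summit

noncomputable section

namespace Summit.ResolutionOfSingularities.ResolutionOfSingularities.Theorems.PIDim4

namespace ResCone

open MvPolynomial Finset
open Literature.AlgebraicGeometry.Resolution
open Literature.AlgebraicGeometry.Resolution.CentreBlowup
open Literature.AlgebraicGeometry.Resolution.Hauser2010
open Literature.AlgebraicGeometry.Resolution.HauserPerlega2019

variable {K : Type} [Field K] [DecidableEq K] (p : ℕ) [Fact p.Prime]

/-- **THE ONE-STEP LEDGER UNDER A HEAVY PERMANENT SET.**  On a constant-shade-`d` tail, at a step `m ≥ k₀` at which every letter of a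
set `P ∌ j m` is kept and `p ≤ d + Σ_{z ∈ P} r_m z`, the mass does not drop, and any further kept letter `y ∉ P`, `y ≠ j m` adds its
weight: `|r_m| + r_m y ≤ |r_{m+1}|`. [OURS · bookkeeping] [cite: HauserPerlega2019PRIMS, §2 (transform D′ of D)] -/
theorem degree_succ_ge_of_permanentSet {c : ℕ → State K} {j : ℕ → Fin 4} {b : ℕ → Fin 4 → K}
    (hc : ∀ k, IsIsolated p (c k).F ∧ Step0 p (c k) (c (k + 1))) (hw : FreeTail.IsWitnessedChain p c j b)
    (hr0 : ∀ e ∈ (c 0).F.support, (c 0).r ≤ e) (hfloor : ∀ k, ordZero (c k).F ≠ p) {k₀ d : ℕ}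
    (hshade : ∀ k, k₀ ≤ k → (c k).shade = (d : ℕ∞)) {m : ℕ} (hm : k₀ ≤ m) {P : Finset (Fin 4)}
    (hP : ∀ z ∈ P, z ≠ j m ∧ b m z = 0) (hW : p ≤ d + ∑ z ∈ P, (c m).r z) {y : Fin 4} (hyP : y ∉ P) (hyj : y ≠ j m)
    (hby : b m y = 0) : (c m).r.degree + (c m).r y ≤ (c (m + 1)).r.degree := by
  classical
  obtain ⟨-, hlaw, -, hband, -⟩ := tail_weights_laws hc hw hr0 hfloor hshade
  have hpm := (hband m hm).1
  have hnew : (c (m + 1)).r (j m) + p = (c m).r.degree + d := by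
    rw [hlaw m hm, Finsupp.coe_update, Function.update_self, Nat.sub_add_cancel hpm.le]
  have hkept : ∀ i, i ≠ j m → b m i = 0 → (c (m + 1)).r i = (c m).r i := fun i hi hb => by
    rw [succ_r_apply_of_ne' p hc hw hfloor m hi, if_pos hb]
  -- the letters `j m`, `y` and `P` are pairwise distinct: their new weights add up below the new mass
  have hjP : j m ∉ P := fun h => (hP _ h).1 rfl
  have hsum : ∑ i ∈ insert (j m) (insert y P), (c (m + 1)).r i ≤ (c (m + 1)).r.degree := by
    rw [Finsupp.degree_eq_sum]
    exact Finset.sum_le_sum_of_subset_of_nonneg (Finset.subset_univ _) fun _ _ _ => Nat.zero_le _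
  rw [Finset.sum_insert (by simp [hyj.symm, hjP]), Finset.sum_insert hyP, hkept y hyj hby] at hsum
  have hPS : ∑ i ∈ P, (c (m + 1)).r i = ∑ i ∈ P, (c m).r i :=
    Finset.sum_congr rfl fun z hz => hkept z (hP z hz).1 (hP z hz).2
  omega

/-- **A PERMANENT SET OF FROZEN WEIGHT `≥ p − d` KILLS THE TAIL** (every prime `p`, every shade `d`; ledger + FT only, no `e_G`
hypothesis): on a witnessed isolated above-floor `Step0 p` chain with `x^{r₀} ∣ F₀` and constant shade `d` from `k₀`, there is no
`M ≥ k₀` and set `P` of letters, none of them charted or translated at any `m ≥ M`, with `p ≤ d + Σ_{z ∈ P} r_M z`. [OURS]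
[cite: CossartJannsenSaito2020, Thm. 3.14, Lemma 13.2] -/
theorem no_tail_of_permanent_weight_ge [CharP K p] {c : ℕ → State K} {j : ℕ → Fin 4} {b : ℕ → Fin 4 → K}
    (hc : ∀ k, IsIsolated p (c k).F ∧ Step0 p (c k) (c (k + 1))) (hw : FreeTail.IsWitnessedChain p c j b)
    (hr0 : ∀ e ∈ (c 0).F.support, (c 0).r ≤ e) (hfloor : ∀ k, ordZero (c k).F ≠ p) {k₀ d : ℕ}
    (hshade : ∀ k, k₀ ≤ k → (c k).shade = (d : ℕ∞)) {M : ℕ} (hM : k₀ ≤ M) {P : Finset (Fin 4)}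
    (hperm : ∀ z ∈ P, ∀ m, M ≤ m → z ≠ j m ∧ b m z = 0) (hW : p ≤ d + ∑ z ∈ P, (c M).r z) : False := by
  classical
  obtain ⟨-, -, -, hband, -⟩ := tail_weights_laws hc hw hr0 hfloor hshade
  -- the weights on `P` are frozen
  have hfrozen : ∀ m, M ≤ m → ∀ z ∈ P, (c m).r z = (c M).r z := by
    intro m hm z hz
    obtain ⟨t, rfl⟩ := Nat.exists_eq_add_of_le hm
    induction t with
    | zero => rfl
    | succ t ih =>
      rw [show M + (t + 1) = M + t + 1 by ring, succ_r_apply_of_ne' p hc hw hfloor (M + t) (hperm z hz _ (by omega)).1,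
        if_pos (hperm z hz _ (by omega)).2]
      exact ih (by omega)
  have hWm : ∀ m, M ≤ m → p ≤ d + ∑ z ∈ P, (c m).r z := fun m hm => by
    rw [Finset.sum_congr rfl fun z hz => hfrozen m hm z hz]; exact hW
  -- the mass never drops …
  have hmono1 : ∀ m, M ≤ m → (c m).r.degree ≤ (c (m + 1)).r.degree := by
    intro m hm
    have hjP : j m ∉ P := fun h => (hperm _ h m hm).1 rfl
    obtain ⟨-, hlaw, -, -, -⟩ := tail_weights_laws hc hw hr0 hfloor hshade
    have hpm := (hband m (by omega)).1
    have hnew : (c (m + 1)).r (j m) + p = (c m).r.degree + d := by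
      rw [hlaw m (by omega), Finsupp.coe_update, Function.update_self, Nat.sub_add_cancel hpm.le]
    have hPS : ∑ i ∈ P, (c (m + 1)).r i = ∑ i ∈ P, (c m).r i :=
      Finset.sum_congr rfl fun z hz => by rw [hfrozen (m + 1) (by omega) z hz, hfrozen m hm z hz]
    have hsum : ∑ i ∈ insert (j m) P, (c (m + 1)).r i ≤ (c (m + 1)).r.degree := by
      rw [Finsupp.degree_eq_sum]
      exact Finset.sum_le_sum_of_subset_of_nonneg (Finset.subset_univ _) fun _ _ _ => Nat.zero_le _
    rw [Finset.sum_insert hjP] at hsum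
    have := hWm m hm
    omega
  have hmono : ∀ m, M ≤ m → ∀ t, (c m).r.degree ≤ (c (m + t)).r.degree := by
    intro m hm t
    induction t with
    | zero => simp
    | succ t ih => exact ih.trans (by rw [show m + (t + 1) = m + t + 1 by ring]; exact hmono1 _ (by omega))
  -- … and rises by ≥ 1 across every satellite step
  have hrise : ∀ k, M ≤ k → FreeTail.IsSatellite j b k → (c (k + 1)).r.degree + 1 ≤ (c (k + 2)).r.degree := by
    intro k hk hsat
    have hyP : j k ∉ P := fun h => (hperm _ h k hk).1 rfl
    have h := degree_succ_ge_of_permanentSet p hc hw hr0 hfloor hshade (show k₀ ≤ k + 1 by omega)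
      (fun z hz => hperm z hz (k + 1) (by omega)) (hWm (k + 1) (by omega)) hyP hsat.1.symm hsat.2
    have h1 := one_le_succ_r_chart p hc hw hfloor k
    rw [show k + 1 + 1 = k + 2 by ring] at h
    omega
  -- hence the mass is unbounded, against the band `|r_m| + d < 2p`
  have hgrow : ∀ n, ∃ m, M ≤ m ∧ (c M).r.degree + n ≤ (c m).r.degree := by
    intro n
    induction n with
    | zero => exact ⟨M, le_rfl, by simp⟩
    | succ n ih =>
      obtain ⟨m, hm, hdeg⟩ := ih
      obtain ⟨k, hk, hsat⟩ := exists_satellite_ge p hc hw m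
      refine ⟨k + 2, by omega, ?_⟩
      have h1 := hmono m hm (k + 1 - m)
      rw [show m + (k + 1 - m) = k + 1 by omega] at h1
      have h2 := hrise k (by omega) hsat
      omega
  obtain ⟨m, hm, hdeg⟩ := hgrow (2 * p)
  have := (hband m (by omega)).2
  omega

/-- **A PERMANENT HEAVY-ENOUGH LETTER KILLS THE TAIL** (every prime `p`, every shade `d`; ledger + FT only): on a witnessed isolated
above-floor `Step0 p` chain with `x^{r₀} ∣ F₀` and constant shade `d` from `k₀`, no letter `h` is neither charted nor translated at any
`m ≥ M` (`M ≥ k₀`) while `p ≤ d + r_M h` — in particular none with `r_M h + n = p`, `n ≤ d`.  No run frame, no `e_G`, no positivity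
hypothesis is needed. [OURS] [cite: CossartJannsenSaito2020, Thm. 3.14, Lemma 13.2] -/
theorem no_tail_of_permanent_heavy_letter [CharP K p] {c : ℕ → State K} {j : ℕ → Fin 4} {b : ℕ → Fin 4 → K}
    (hc : ∀ k, IsIsolated p (c k).F ∧ Step0 p (c k) (c (k + 1))) (hw : FreeTail.IsWitnessedChain p c j b)
    (hr0 : ∀ e ∈ (c 0).F.support, (c 0).r ≤ e) (hfloor : ∀ k, ordZero (c k).F ≠ p) {k₀ d : ℕ}
    (hshade : ∀ k, k₀ ≤ k → (c k).shade = (d : ℕ∞)) {M : ℕ} (hM : k₀ ≤ M) {h : Fin 4}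
    (hperm : ∀ m, M ≤ m → j m ≠ h ∧ b m h = 0) (hW : p ≤ d + (c M).r h) : False :=
  no_tail_of_permanent_weight_ge p hc hw hr0 hfloor hshade hM (P := {h})
    (fun z hz m hm => by rw [Finset.mem_singleton.1 hz]; exact ⟨(hperm m hm).1.symm, (hperm m hm).2⟩) (by simpa using hW)

/-- **COROLLARY (the K^ω shape)**: with `r_{k₁} h + n = p`, `n ≤ d` and `h` permanent from `k₁ ≥ k₀`, the tail is impossible.
[OURS] [cite: CossartJannsenSaito2020, Thm. 3.14, Lemma 13.2] -/
theorem no_tail_of_permanent_heavy_letter' [CharP K p] {c : ℕ → State K} {j : ℕ → Fin 4} {b : ℕ → Fin 4 → K}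
    (hc : ∀ k, IsIsolated p (c k).F ∧ Step0 p (c k) (c (k + 1))) (hw : FreeTail.IsWitnessedChain p c j b)
    (hr0 : ∀ e ∈ (c 0).F.support, (c 0).r ≤ e) (hfloor : ∀ k, ordZero (c k).F ≠ p) {k₀ d n : ℕ} (hnd : n ≤ d)
    (hshade : ∀ k, k₀ ≤ k → (c k).shade = (d : ℕ∞)) {k₁ : ℕ} (hk₁ : k₀ ≤ k₁) {h : Fin 4}
    (hrn : (c k₁).r h + n = p) (hperm : ∀ k, k₁ ≤ k → j k ≠ h ∧ b k h = 0) : False :=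
  no_tail_of_permanent_heavy_letter p hc hw hr0 hfloor hshade hk₁ hperm (by omega)

end ResCone

end Summit.ResolutionOfSingularities.ResolutionOfSingularities.Theorems.PIDim4

end
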